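import Summits.NavierStokesRegularity.FunctionalMining.RateBudgets
import Literature.Analysis.FluidPDE.HarmonicProbe
import Literature.Analysis.FluidPDE.WholeSpaceIBP
import Literature.Analysis.FunctionSpaces.TorusPlantingTools
import Literature.Analysis.FunctionSpaces.TorusPeriodizationCube
import Literature.Analysis.FunctionSpaces.TorusCompactSupportZeroMean
import HarnessLib

/-!
# Functional mining: planting a concentrated bump on `T³` (no-go branch, row C1)

Search for candidate a priori estimates; no regularity claim.

Cell `pub-nsfunc` (host summit NavierStokesRegularity, topic `FunctionalMining`), NO-GO branch,
target `EnstrophyQuadraticBudget C` (`RateBudgets.lean`, census row C1). The criterion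
`not_enstrophyQuadraticBudget_of_scaling_family` (`QuadraticBudgetStatic.lean`) asks for a family
of smooth divergence-free zero-mean fields on `T³` along which the enstrophy production `σ`, the
enstrophy `ℰ` and the Laplacian dissipation `D = ∫‖Δ·‖²` scale like `n³, n, n³`. This file
provides the two devices that turn ONE compactly supported divergence-free field `U` on
`ℝ³ = EuclideanSpace ℝ (Fin 3)` into such a family (Sieve 1 of `Sieves.lean`, made concrete):

* **concentration on `ℝ³`** (`§ Scaling`): the field `y ↦ c U(c (y + a))`, `c > 0`, is smooth,
  divergence free, supported in `B̄(−a, R/c)` if `U` is supported in `B̄(0, R)`, and its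
  production / gradient norm / Laplacian norm are `c³ σ(U)`, `c · ‖∇U‖₂²`, `c³ D(U)`
  (`production_plant`, `gradNormSq_plant`, `laplacianNormSq_plant`; chain rule
  `FluidPDE/HarmonicProbe` and the change of variables `Measure.integral_comp_smul`);
* **planting on `T³`** (`§ Transfer`): for a smooth compactly supported divergence-free `g`
  supported in the open unit cube, the periodisation `Torus.periodize g`
  (`FunctionSpaces/TorusPeriodization`) is smooth, divergence free and of zero mean
  (`FunctionSpaces/TorusPlantingTools`, `TorusCompactSupportZeroMean`), and its enstrophy
  production, enstrophy and Laplacian dissipation are the corresponding whole-space integrals of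
  `g` (`enstrophyProduction_periodize`, `torusEnstrophy_periodize`,
  `laplacianNormSq_periodize`; one lattice term on the fundamental cube).

No definitions; the assembly is `QuadraticBudgetRefutation.lean`.
-/

noncomputable section

open MeasureTheory Set Filter Topology InnerProductSpace Metric
open scoped RealInnerProductSpace Laplacian ContDiff

namespace Summit.NavierStokesRegularity.FunctionalMining

open Literature.Analysis.FunctionSpaces Literature.Analysis.FluidPDE

/-! ## Scaling: the concentrated field `y ↦ c U(c (y + a))` on `ℝ³` -/

section Scaling

variable {U : EuclideanSpace ℝ (Fin 3) → EuclideanSpace ℝ (Fin 3)} {c : ℝ}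
  {a : EuclideanSpace ℝ (Fin 3)}

/-- The concentrated field is smooth. [folklore] -/
theorem contDiff_plant (hU : ContDiff ℝ ∞ U) (c : ℝ) (a : EuclideanSpace ℝ (Fin 3)) :
    ContDiff ℝ ∞ (fun y => c • U (c • (y + a))) := by
  fun_prop

/-- Chain rule: `D[c U(c(· + a))](y) = c² DU(c (y + a))`. [folklore] -/
theorem fderiv_plant (U : EuclideanSpace ℝ (Fin 3) → EuclideanSpace ℝ (Fin 3)) (hc : c ≠ 0)
    (a y : EuclideanSpace ℝ (Fin 3)) :
    fderiv ℝ (fun y => c • U (c • (y + a))) y = (c * c) • fderiv ℝ U (c • (y + a)) := by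
  rw [fderiv_comp_add_right (f := fun w => c • U (c • w)) a, fderiv_const_smul_comp_smul U c hc]

/-- Chain rule: `Δ[c U(c(· + a))](y) = c³ (ΔU)(c (y + a))`. [folklore] -/
theorem laplacian_plant (U : EuclideanSpace ℝ (Fin 3) → EuclideanSpace ℝ (Fin 3)) (hc : c ≠ 0)
    (a y : EuclideanSpace ℝ (Fin 3)) :
    Δ (fun y => c • U (c • (y + a))) y = (c * c ^ 2) • Δ U (c • (y + a)) := by
  rw [Torus.laplacian_comp_add_right (fun w => c • U (c • w)) a y,
    laplacian_const_smul_comp_smul U c hc]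

/-- The concentrated field of a divergence-free field is divergence free (the derivative is a
multiple of the original one at the rescaled point). [folklore] -/
theorem trace_fderiv_plant (hc : c ≠ 0)
    (hU : ∀ z, LinearMap.trace ℝ _ (fderiv ℝ U z : EuclideanSpace ℝ (Fin 3) →ₗ[ℝ]
      EuclideanSpace ℝ (Fin 3)) = 0) (a y : EuclideanSpace ℝ (Fin 3)) :
    LinearMap.trace ℝ _ (fderiv ℝ (fun y => c • U (c • (y + a))) y :
      EuclideanSpace ℝ (Fin 3) →ₗ[ℝ] EuclideanSpace ℝ (Fin 3)) = 0 := by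
  rw [fderiv_plant U hc a y]
  simp [hU]

/-- Support: if `U` is supported in `B̄(0, R)` then `c U(c(· + a))`, `c > 0`, is supported in
`B̄(−a, R/c)`. [folklore] -/
theorem tsupport_plant (hc : 0 < c) {R : ℝ} (hU : tsupport U ⊆ closedBall 0 R)
    (a : EuclideanSpace ℝ (Fin 3)) :
    tsupport (fun y => c • U (c • (y + a))) ⊆ closedBall (-a) (R / c) := by
  refine closure_minimal (fun y hy => ?_) isClosed_closedBall
  have h1 : U (c • (y + a)) ≠ 0 := by
    intro h
    exact Function.mem_support.1 hy (by simp only [h, smul_zero])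
  have h2 : c • (y + a) ∈ closedBall (0 : EuclideanSpace ℝ (Fin 3)) R :=
    hU (subset_closure (Function.mem_support.2 h1))
  rw [mem_closedBall_zero_iff, norm_smul, Real.norm_eq_abs, abs_of_pos hc] at h2
  rw [mem_closedBall, dist_eq_norm, sub_neg_eq_add, le_div_iff₀ hc, mul_comm]
  exact h2

/-- The concentrated field of a compactly supported field is compactly supported. [folklore] -/
theorem hasCompactSupport_plant (hc : 0 < c) (hU : HasCompactSupport U)
    (a : EuclideanSpace ℝ (Fin 3)) : HasCompactSupport (fun y => c • U (c • (y + a))) := by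
  obtain ⟨R, hR⟩ := (hU : IsCompact (tsupport U)).isBounded.subset_closedBall 0
  exact HasCompactSupport.of_support_subset_isCompact (isCompact_closedBall (-a) (R / c))
    (subset_closure.trans (tsupport_plant hc hR a))

/-- Change of variables behind the scaling laws: `∫ F(c (y + a)) dy = c⁻³ ∫ F` on `ℝ³`, `c > 0`
(translation invariance and `Measure.integral_comp_smul`). [folklore] -/
theorem integral_comp_plant (F : EuclideanSpace ℝ (Fin 3) → ℝ) (hc : 0 < c)
    (a : EuclideanSpace ℝ (Fin 3)) :
    (∫ y, F (c • (y + a))) = (c ^ 3)⁻¹ * ∫ z, F z := by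
  have h1 : (∫ y, F (c • (y + a))) = ∫ y, F (c • y) :=
    integral_add_right_eq_self (fun y => F (c • y)) a
  rw [h1, Measure.integral_comp_smul volume F c, finrank_euclideanSpace_fin, smul_eq_mul,
    abs_of_pos (inv_pos.2 (pow_pos hc 3))]

/-- **Production scales like `c³`**: `σ(c U(c(· + a))) = c³ σ(U)` (`σ = ∫⟪(U·∇)U, ΔU⟫`;
Navier–Stokes degree `3` of Sieve 1). [folklore] -/
theorem production_plant (U : EuclideanSpace ℝ (Fin 3) → EuclideanSpace ℝ (Fin 3)) (hc : 0 < c)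
    (a : EuclideanSpace ℝ (Fin 3)) :
    (∫ y, ⟪fderiv ℝ (fun y => c • U (c • (y + a))) y (c • U (c • (y + a))),
        Δ (fun y => c • U (c • (y + a))) y⟫) =
      c ^ 3 * ∫ z, ⟪fderiv ℝ U z (U z), Δ U z⟫ := by
  have hpt : ∀ y, ⟪fderiv ℝ (fun y => c • U (c • (y + a))) y (c • U (c • (y + a))),
      Δ (fun y => c • U (c • (y + a))) y⟫ =
      c ^ 6 * (fun z => ⟪fderiv ℝ U z (U z), Δ U z⟫) (c • (y + a)) := fun y => by
    rw [fderiv_plant U hc.ne' a y, laplacian_plant U hc.ne' a y]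
    simp only [smul_apply, map_smul, real_inner_smul_left,
      real_inner_smul_right]
    ring
  rw [integral_congr_ae (ae_of_all _ hpt), integral_const_mul,
    integral_comp_plant (fun z => ⟪fderiv ℝ U z (U z), Δ U z⟫) hc a, ← mul_assoc]
  congr 1
  field_simp

/-- **The squared gradient norm scales like `c`**: `∫ Σᵢ ‖∂ᵢ(c U(c(·+a)))‖² = c ∫ Σᵢ ‖∂ᵢU‖²`
(degree `1`). [folklore] -/
theorem gradNormSq_plant (U : EuclideanSpace ℝ (Fin 3) → EuclideanSpace ℝ (Fin 3)) (hc : 0 < c)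
    (a : EuclideanSpace ℝ (Fin 3)) :
    (∫ y, ∑ i, ‖fderiv ℝ (fun y => c • U (c • (y + a))) y (EuclideanSpace.single i 1)‖ ^ 2) =
      c * ∫ z, ∑ i, ‖fderiv ℝ U z (EuclideanSpace.single i 1)‖ ^ 2 := by
  have hpt : ∀ y, (∑ i, ‖fderiv ℝ (fun y => c • U (c • (y + a))) y (EuclideanSpace.single i 1)‖ ^ 2)
      = c ^ 4 * (fun z => ∑ i, ‖fderiv ℝ U z (EuclideanSpace.single i 1)‖ ^ 2) (c • (y + a)) :=
    fun y => by
    rw [fderiv_plant U hc.ne' a y]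
    simp only [smul_apply, norm_smul, mul_pow, Real.norm_eq_abs,
      Finset.mul_sum]
    refine Finset.sum_congr rfl fun i _ => ?_
    rw [abs_mul, abs_of_pos hc]
    ring
  rw [integral_congr_ae (ae_of_all _ hpt), integral_const_mul,
    integral_comp_plant (fun z => ∑ i, ‖fderiv ℝ U z (EuclideanSpace.single i 1)‖ ^ 2) hc a,
    ← mul_assoc]
  congr 1
  field_simp

/-- **The Laplacian dissipation scales like `c³`**: `∫‖Δ(c U(c(·+a)))‖² = c³ ∫‖ΔU‖²`
(degree `3`). [folklore] -/
theorem laplacianNormSq_plant (U : EuclideanSpace ℝ (Fin 3) → EuclideanSpace ℝ (Fin 3))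
    (hc : 0 < c) (a : EuclideanSpace ℝ (Fin 3)) :
    (∫ y, ‖Δ (fun y => c • U (c • (y + a))) y‖ ^ 2) = c ^ 3 * ∫ z, ‖Δ U z‖ ^ 2 := by
  have hpt : ∀ y, ‖Δ (fun y => c • U (c • (y + a))) y‖ ^ 2 =
      c ^ 6 * (fun z => ‖Δ U z‖ ^ 2) (c • (y + a)) := fun y => by
    rw [laplacian_plant U hc.ne' a y, norm_smul, mul_pow, Real.norm_eq_abs, abs_mul,
      abs_of_pos hc, abs_of_pos (pow_pos hc 2)]
    ring
  rw [integral_congr_ae (ae_of_all _ hpt), integral_const_mul,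
    integral_comp_plant (fun z => ‖Δ U z‖ ^ 2) hc a, ← mul_assoc]
  congr 1
  field_simp

end Scaling

/-! ## Transfer: periodisation of a field supported in the open unit cube -/

section Transfer

variable {g : EuclideanSpace ℝ (Fin 3) → EuclideanSpace ℝ (Fin 3)}

/-- A field with topological support in the open unit cube vanishes off it, and so do its
derivative and its Laplacian. [folklore] -/
theorem eq_zero_off_cube (hgs : tsupport g ⊆ {y | ∀ i, y i ∈ Ioo (0 : ℝ) 1}) :
    (∀ y : EuclideanSpace ℝ (Fin 3), (¬ ∀ i, y i ∈ Ioo (0 : ℝ) 1) → g y = 0) ∧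
      (∀ y : EuclideanSpace ℝ (Fin 3), (¬ ∀ i, y i ∈ Ioo (0 : ℝ) 1) → fderiv ℝ g y = 0) ∧
      ∀ y : EuclideanSpace ℝ (Fin 3), (¬ ∀ i, y i ∈ Ioo (0 : ℝ) 1) → Δ g y = 0 := by
  refine ⟨Torus.eq_zero_of_tsupport_subset_openCube hgs, fun y hy => ?_, fun y hy => ?_⟩
  · exact fderiv_of_notMem_tsupport ℝ fun h => hy (hgs h)
  · exact laplacian_eq_zero_of_notMem_tsupport fun h => hy (hgs h)

/-- **Planting: smooth, divergence free, zero mean.** The periodisation of a smooth compactly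
supported divergence-free field supported in the open unit cube is a smooth divergence-free
zero-mean field on `T³`. [folklore] -/
theorem periodize_smooth_divFree_zeroMean (hg : ContDiff ℝ ∞ g) (hgc : HasCompactSupport g)
    (hgs : tsupport g ⊆ {y | ∀ i, y i ∈ Ioo (0 : ℝ) 1})
    (hdiv : ∀ z, LinearMap.trace ℝ _ (fderiv ℝ g z : EuclideanSpace ℝ (Fin 3) →ₗ[ℝ]
      EuclideanSpace ℝ (Fin 3)) = 0) :
    Torus.IsSmooth (Torus.periodize g) ∧ Torus.IsDivFree (Torus.periodize g) ∧
      Torus.HasZeroMean (Torus.periodize g) := by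
  have hR := Torus.tsupport_subset_closedBall_of_openCube hgs
  have hsm : Torus.IsSmooth (Torus.periodize g) := Torus.isSmooth_periodize hg hR
  have hdf : Torus.IsDivFree (Torus.periodize g) :=
    Torus.isDivFree_periodize_of_cube hg (isClosed_tsupport g) hgs
      (fun y hy => image_eq_zero_of_notMem_tsupport hy) hdiv
  refine ⟨hsm, hdf, Torus.hasZeroMean_of_isDivFree_of_forall_eq_zero hsm hdf hgc hgs
    fun y hy hyK => ?_⟩
  rw [Torus.periodize_proj,
    Torus.perSum_eq_self_of_mem_unitCube (Torus.eq_zero_of_tsupport_subset_openCube hgs) hy]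
  exact image_eq_zero_of_notMem_tsupport hyK

/-- **Planting: enstrophy production.** `σ_T(periodize g) = ∫_{ℝ³} ⟪(g·∇)g, Δg⟫` (one lattice
term on the fundamental cube). [folklore] -/
theorem enstrophyProduction_periodize (hg : ContDiff ℝ ∞ g)
    (hgs : tsupport g ⊆ {y | ∀ i, y i ∈ Ioo (0 : ℝ) 1}) :
    enstrophyProduction (Torus.periodize g) = ∫ y, ⟪fderiv ℝ g y (g y), Δ g y⟫ := by
  obtain ⟨h0, h1, h2⟩ := eq_zero_off_cube hgs
  have hR := Torus.tsupport_subset_closedBall_of_openCube hgs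
  unfold enstrophyProduction
  refine Torus.integral_eq_integral_of_forall_proj_eq (fun y hy => ?_) fun y hy => ?_
  · simp only [Torus.convect]
    rw [Torus.fderiv_periodize (hg.of_le (WithTop.coe_le_coe.mpr le_top)) hR,
      Torus.laplacian_periodize (hg.of_le (WithTop.coe_le_coe.mpr le_top)) hR, Torus.periodize_proj,
      Torus.perSum_eq_self_of_mem_unitCube h0 hy, Torus.perSum_eq_self_of_mem_unitCube h1 hy,
      Torus.perSum_eq_self_of_mem_unitCube h2 hy]
  · have hy' : ¬ ∀ i, y i ∈ Ioo (0 : ℝ) 1 := fun h => hy fun i => Ioo_subset_Ico_self (h i)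
    simp [h0 y hy']

/-- **Planting: enstrophy.** `ℰ(periodize g) = ½ ∫_{ℝ³} Σᵢ ‖∂ᵢ g‖²`. [folklore] -/
theorem torusEnstrophy_periodize (hg : ContDiff ℝ ∞ g)
    (hgs : tsupport g ⊆ {y | ∀ i, y i ∈ Ioo (0 : ℝ) 1}) :
    torusEnstrophy (Torus.periodize g) =
      2⁻¹ * ∫ y, ∑ i, ‖fderiv ℝ g y (EuclideanSpace.single i 1)‖ ^ 2 := by
  obtain ⟨h0, h1, h2⟩ := eq_zero_off_cube hgs
  have hR := Torus.tsupport_subset_closedBall_of_openCube hgs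
  have hsm : Torus.IsContDiff 1 (Torus.periodize g) :=
    (Torus.isSmooth_periodize hg hR).isContDiff (WithTop.coe_le_coe.mpr le_top)
  unfold torusEnstrophy Torus.gradNormSq
  congr 1
  refine Torus.integral_eq_integral_of_forall_proj_eq (fun y hy => ?_) fun y hy => ?_
  · refine Finset.sum_congr rfl fun i _ => ?_
    rw [Torus.partialDeriv_eq_fderiv_apply hsm,
      Torus.fderiv_periodize (hg.of_le (WithTop.coe_le_coe.mpr le_top)) hR,
      Torus.perSum_eq_self_of_mem_unitCube h1 hy]
  · have hy' : ¬ ∀ i, y i ∈ Ioo (0 : ℝ) 1 := fun h => hy fun i => Ioo_subset_Ico_self (h i)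
    simp [h1 y hy']

/-- **Planting: Laplacian dissipation.** `∫_{T³} ‖Δ(periodize g)‖² = ∫_{ℝ³} ‖Δg‖²`. [folklore] -/
theorem laplacianNormSq_periodize (hg : ContDiff ℝ ∞ g)
    (hgs : tsupport g ⊆ {y | ∀ i, y i ∈ Ioo (0 : ℝ) 1}) :
    (∫ x, ‖Torus.laplacian (Torus.periodize g) x‖ ^ 2) = ∫ y, ‖Δ g y‖ ^ 2 := by
  obtain ⟨h0, h1, h2⟩ := eq_zero_off_cube hgs
  have hR := Torus.tsupport_subset_closedBall_of_openCube hgs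
  refine Torus.integral_eq_integral_of_forall_proj_eq (fun y hy => ?_) fun y hy => ?_
  · rw [Torus.laplacian_periodize (hg.of_le (WithTop.coe_le_coe.mpr le_top)) hR,
      Torus.perSum_eq_self_of_mem_unitCube h2 hy]
  · have hy' : ¬ ∀ i, y i ∈ Ioo (0 : ℝ) 1 := fun h => hy fun i => Ioo_subset_Ico_self (h i)
    simp [h2 y hy']

end Transfer

end Summit.NavierStokesRegularity.FunctionalMining

end
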